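import Literature.NumberTheory.EllipticCurves.FormalGroupFrobeniusTypeProofs
import Mathlib.Analysis.Normed.Group.Ultra
import HarnessLib

/-!
# Route `CyclotomicUntwist`: the source side of the D5 pin — the classes `[log]`, `[log(Tᵖ)]` of a supersingular
# logarithm of Honda type `p − aT + T²` (`p ∣ a`) are non-zero and INDEPENDENT modulo bounded series, and
# Frobenius `f ↦ f(Tᵖ)` acts on them by the companion matrix of `X² − aX + p` modulo `p`-small series

Cell `pub/bsd-wall` (D-0145 line `route-BirchSwinnertonDyer-CyclotomicUntwist`), prover seat `bsd-line-cycu-p2`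
(gen 6), lane «D5 TYPING» (memo `Cruxes/PSRankOneLowerHalfAtThree/D5-TYPING-v1.md` §3–§4, row 3 "unramified
template"). THEOREMS ONLY (no definition, no named fact, no `sorry`); helper `--supports` K1 =
stmt-BirchSwinnertonDyer-21580 (serves K2 = 21581 equally). BSD is not proved by this file and no crux is.

THE POINT. In Katz's model of the Dieudonné module of a one-dimensional formal group over a `ℤ`-flat ring
(`D(G/R) = {f : f′ integral, ∂f integral}/{f integral}`, Katz 1981 Lemma 5.1.2 / Thm 5.1.4 — rationally: modulo
series with BOUNDED coefficients) the D5 predicate of the memo pins the descended Frobenius of a K1/K2 row by the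
`L`-coordinates of `[ω̂], [η̂]` on the pair `(Ψ[log₀], Ψ[log₀(T³)])`, `Ψ[f] = [f(T⁹)]`, `log₀` = the logarithm of
the CANONICAL `ℤ₃`-lift `V₀ = y² = x³ − x + b` of the special fibre `y² = x³ − x + b̄`. Uniqueness (u) of that pin
is exactly: **`x·log₀ + y·log₀(Tᵖ)` has bounded coefficients only for `x = y = 0`** — over `ℚ_p` and over every
ultrametric normed extension `K ⊇ ℚ_p` (the route reads it in `L = ℚ₃(ζ₉)` or `ℂ₃`). This file proves it from
the tree's Honda congruence `hondaShift p a log ∈ ℤ_p⟦X⟧` (`WeierstrassCurve.norm_coeff_hondaShift_formalLog_le_one`,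
Honda 1970 Thm 9) in the SUPERSINGULAR case `p ∣ a`, through the exact valuation pattern
**`‖[X^{p^{2k}}] log‖ = pᵏ`, `‖[X^{p^{2k+1}}] log‖ ≤ pᵏ`** (`norm_coeff_pow_pattern`: induction on the congruence at
`X^{p^j}`, the `(1/p)·[X^{p^{j−2}}]` term dominating strictly at even `j`); hence `[log] ≠ 0`
(`norm_coeff_formalLog_unbounded`), the independence (`eq_zero_of_norm_coeff_combination_le`,
`combination_coeffs_unique`), and the Frobenius relation: `F : f ↦ f(Tᵖ) = expand p` satisfies
`F(x·log + y·F log) ≡ (−p·y)·log + (x + a·y)·F log` modulo a series with coefficients of norm `≤ ‖y‖·p⁻¹`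
(`expand_combination_companion`, `norm_coeff_frobenius_relation_le`: `log(X^{p²}) − a·log(Xᵖ) + p·log = p·hondaShift`)
— the companion matrix of `X² − aX + p` on `(log, F log)`, i.e. the Honda-type relation `(F² − aF + p)[log] = 0` that
`CyclotomicUntwistDescendedFrobeniusCharpoly` turns into `tr = a`, `det = p`. The sequel
`CyclotomicUntwistSecondKindLogClassesLift` instantiates at `p = 3` on the canonical lifts `⟨0, 0, 0, −1, b⟩ / ℤ₃` of the
K1/K2 special fibres `y² = x³ − x + b̄` (trace `a = −3·valMinAbs b̄ ∈ {0, ±3}`). Nothing about the ramified side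
(`Ψ`, the good model) is asserted here.
[cite: Katz1981CrystallineDieudonne, §5 (5.1.2–5.1.4)] [cite: Honda1970, Thm. 9] [cite: Kobayashi2013, §3.1]
-/

set_option autoImplicit false
-- single-conjunct summit: `Summit.BirchSwinnertonDyer.BirchSwinnertonDyer.…` repeats the name by design
set_option linter.dupNamespace false

noncomputable section

open PowerSeries Literature.RingTheory.FormalGroups

namespace Summit.BirchSwinnertonDyer.BirchSwinnertonDyer.Theorems.SecondKindLogClasses

/-! ## §1 The valuation pattern of a supersingular Honda logarithm -/

section Pattern

variable {p : ℕ} [hp : Fact p.Prime]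

/-- The `Xᵖ`-coefficient of `hondaShift`: `[Xᵖ] = ℓ_p − (a/p)·ℓ₁`. [cite: Honda1970, §2] -/
theorem coeff_hondaShift_prime (a : ℚ_[p]) (ℓ : ℚ_[p]⟦X⟧) :
    coeff p (hondaShift p a ℓ) = coeff p ℓ - a / p * coeff 1 ℓ := by
  rw [coeff_hondaShift, if_pos (dvd_refl p), Nat.div_self hp.out.pos, if_neg]
  · ring
  · intro h
    have hle := Nat.le_of_dvd hp.out.pos h
    rw [pow_two] at hle
    exact absurd hle (not_le.mpr (lt_mul_of_one_lt_left hp.out.pos hp.out.one_lt))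

/-- The `X^{p^{j+2}}`-coefficient of `hondaShift`: `ℓ_{p^{j+2}} − (a/p)ℓ_{p^{j+1}} + (1/p)ℓ_{p^j}`.
[cite: Honda1970, §2] -/
theorem coeff_hondaShift_pow_add_two (a : ℚ_[p]) (ℓ : ℚ_[p]⟦X⟧) (j : ℕ) :
    coeff (p ^ (j + 2)) (hondaShift p a ℓ) =
      coeff (p ^ (j + 2)) ℓ - a / p * coeff (p ^ (j + 1)) ℓ + 1 / (p : ℚ_[p]) * coeff (p ^ j) ℓ := by
  have hp0 : 0 < p := hp.out.pos
  have h1 : p ∣ p ^ (j + 2) := dvd_pow_self p (by omega)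
  have h2 : p ^ 2 ∣ p ^ (j + 2) := pow_dvd_pow p (by omega)
  have e1 : p ^ (j + 2) / p = p ^ (j + 1) := by
    rw [pow_succ, Nat.mul_div_cancel _ hp0]
  have e2 : p ^ (j + 2) / p ^ 2 = p ^ j := by
    rw [pow_add, Nat.mul_div_cancel _ (pow_pos hp0 2)]
  rw [coeff_hondaShift, if_pos h1, if_pos h2, e1, e2]

/-- **The valuation pattern.** If `ℓ ∈ ℚ_p⟦X⟧` has `[X¹]ℓ = 1`, is of Honda type `p − aT + T²`
(`hondaShift p a ℓ ∈ ℤ_p⟦X⟧`) and `‖a‖ ≤ p⁻¹` (SUPERSINGULAR), then for every `k`: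
`‖[X^{p^{2k}}]ℓ‖ = pᵏ` and `‖[X^{p^{2k+1}}]ℓ‖ ≤ pᵏ`. (Induction on the congruence at `X^{p^j}`: at even `j` the
term `(1/p)·[X^{p^{j−2}}]ℓ` has norm `p·p^{k}` and strictly dominates.) [cite: Honda1970, Thm. 9]
[cite: Katz1981CrystallineDieudonne, §5] -/
theorem norm_coeff_pow_pattern {a : ℚ_[p]} (ha : ‖a‖ ≤ (p : ℝ)⁻¹) {ℓ : ℚ_[p]⟦X⟧} (h1 : coeff 1 ℓ = 1)
    (hT : ∀ n, ‖coeff n (hondaShift p a ℓ)‖ ≤ 1) (k : ℕ) :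
    ‖coeff (p ^ (2 * k)) ℓ‖ = (p : ℝ) ^ k ∧ ‖coeff (p ^ (2 * k + 1)) ℓ‖ ≤ (p : ℝ) ^ k := by
  have hp1 : (1 : ℝ) < p := by exact_mod_cast hp.out.one_lt
  have hp0 : (0 : ℝ) < p := by positivity
  have hnp : ‖(p : ℚ_[p])‖ = (p : ℝ)⁻¹ := Padic.norm_p
  have hninv : ‖(1 / (p : ℚ_[p]))‖ = p := by rw [one_div, norm_inv, hnp, inv_inv]
  have hap : ‖a / p‖ ≤ 1 := by
    rw [norm_div, hnp, div_inv_eq_mul]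
    calc ‖a‖ * p ≤ (p : ℝ)⁻¹ * p := by gcongr
      _ = 1 := inv_mul_cancel₀ hp0.ne'
  induction k with
  | zero =>
    refine ⟨?_, ?_⟩
    · simp [h1]
    · have h := hT p
      rw [coeff_hondaShift_prime, h1, mul_one] at h
      simp only [mul_zero, zero_add, pow_one, pow_zero]
      calc ‖coeff p ℓ‖ = ‖(coeff p ℓ - a / p) + a / p‖ := by rw [sub_add_cancel]
        _ ≤ max ‖coeff p ℓ - a / p‖ ‖a / p‖ := Padic.nonarchimedean _ _
        _ ≤ 1 := max_le h hap
  | succ k ih =>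
    obtain ⟨he, ho⟩ := ih
    have hpk : (1 : ℝ) ≤ (p : ℝ) ^ k := one_le_pow₀ hp1.le
    have hpk1 : (p : ℝ) ^ k < (p : ℝ) ^ (k + 1) := pow_lt_pow_right₀ hp1 (by omega)
    have hE := hT (p ^ (2 * k + 2))
    rw [coeff_hondaShift_pow_add_two] at hE
    have hO := hT (p ^ ((2 * k + 1) + 2))
    rw [coeff_hondaShift_pow_add_two, show 2 * k + 1 + 1 = 2 * k + 2 by ring] at hO
    rw [show 2 * (k + 1) = 2 * k + 2 by ring, show 2 * k + 2 + 1 = (2 * k + 1) + 2 by ring]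
    set e0 := coeff (p ^ (2 * k)) ℓ with he0
    set e1 := coeff (p ^ (2 * k + 1)) ℓ with he1
    set e2 := coeff (p ^ (2 * k + 2)) ℓ with he2
    set e3 := coeff (p ^ ((2 * k + 1) + 2)) ℓ with he3
    -- even index `2k + 2`
    have hB : ‖1 / (p : ℚ_[p]) * e0‖ = (p : ℝ) ^ (k + 1) := by
      rw [norm_mul, hninv, he, pow_succ, mul_comm]
    have hA : ‖(e2 - a / p * e1 + 1 / (p : ℚ_[p]) * e0) + a / p * e1‖ ≤ (p : ℝ) ^ k := by
      calc _ ≤ max ‖e2 - a / p * e1 + 1 / (p : ℚ_[p]) * e0‖ ‖a / p * e1‖ := Padic.nonarchimedean _ _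
        _ ≤ (p : ℝ) ^ k := by
          refine max_le (le_trans hE hpk) ?_
          rw [norm_mul]
          calc ‖a / p‖ * ‖e1‖ ≤ 1 * (p : ℝ) ^ k := by gcongr
            _ = (p : ℝ) ^ k := one_mul _
    have he2' : e2 = ((e2 - a / p * e1 + 1 / (p : ℚ_[p]) * e0) + a / p * e1) + -(1 / (p : ℚ_[p]) * e0) := by
      ring
    have hEven : ‖e2‖ = (p : ℝ) ^ (k + 1) := by
      have hne : ‖(e2 - a / p * e1 + 1 / (p : ℚ_[p]) * e0) + a / p * e1‖ ≠ ‖-(1 / (p : ℚ_[p]) * e0)‖ := by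
        rw [norm_neg, hB]; exact (lt_of_le_of_lt hA hpk1).ne
      rw [he2', Padic.add_eq_max_of_ne hne, norm_neg, hB]
      exact max_eq_right (le_trans hA hpk1.le)
    refine ⟨hEven, ?_⟩
    -- odd index `2k + 3`
    have he3' : e3 = (e3 - a / p * e2 + 1 / (p : ℚ_[p]) * e1) + a / p * e2 + -(1 / (p : ℚ_[p]) * e1) := by
      ring
    rw [he3']
    calc _ ≤ max ‖(e3 - a / p * e2 + 1 / (p : ℚ_[p]) * e1) + a / p * e2‖ ‖-(1 / (p : ℚ_[p]) * e1)‖ :=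
          Padic.nonarchimedean _ _
      _ ≤ (p : ℝ) ^ (k + 1) := by
        refine max_le ?_ ?_
        · calc _ ≤ max ‖e3 - a / p * e2 + 1 / (p : ℚ_[p]) * e1‖ ‖a / p * e2‖ := Padic.nonarchimedean _ _
            _ ≤ (p : ℝ) ^ (k + 1) := by
              refine max_le (le_trans hO (le_trans hpk hpk1.le)) ?_
              rw [norm_mul, hEven]
              calc ‖a / p‖ * (p : ℝ) ^ (k + 1) ≤ 1 * (p : ℝ) ^ (k + 1) := by gcongr
                _ = (p : ℝ) ^ (k + 1) := one_mul _
        · rw [norm_neg, norm_mul, hninv, pow_succ, mul_comm]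
          gcongr

/-- **`[log] ≠ 0` in Katz's `D_ℚ`: the coefficients of `ℓ` are UNBOUNDED.** [cite: Katz1981CrystallineDieudonne, §5] -/
theorem norm_coeff_unbounded {a : ℚ_[p]} (ha : ‖a‖ ≤ (p : ℝ)⁻¹) {ℓ : ℚ_[p]⟦X⟧} (h1 : coeff 1 ℓ = 1)
    (hT : ∀ n, ‖coeff n (hondaShift p a ℓ)‖ ≤ 1) (C : ℝ) : ∃ n : ℕ, C < ‖coeff n ℓ‖ := by
  have hp1 : (1 : ℝ) < p := by exact_mod_cast hp.out.one_lt
  obtain ⟨k, hk⟩ := pow_unbounded_of_one_lt C hp1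
  exact ⟨p ^ (2 * k), by rw [(norm_coeff_pow_pattern ha h1 hT k).1]; exact hk⟩

end Pattern

/-! ## §2 Independence of `[ℓ]` and `[ℓ(Xᵖ)]` modulo bounded series, over any ultrametric `K ⊇ ℚ_p`,
and the Frobenius relation -/

section Independence

variable {p : ℕ} [hp : Fact p.Prime] {K : Type*} [NormedField K] [NormedAlgebra ℚ_[p] K] [IsUltrametricDist K]

/-- **Independence, coefficient form.** With `ℓ` as in §1 read in `K` through `ι = algebraMap ℚ_p K`: if the numbers
`x·ι(ℓ_{p^{j+1}}) + y·ι(ℓ_{p^j})` (the `X^{p^{j+1}}`-coefficients of `x·ℓ + y·ℓ(Xᵖ)`) are bounded, then `x = y = 0`.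
(If `‖y‖ ≤ ‖x‖` read `j + 1 = 2k`: norm `‖x‖pᵏ`; else read `j = 2k`: norm `‖y‖pᵏ`.)
[cite: Katz1981CrystallineDieudonne, §5] -/
theorem eq_zero_of_norm_combination_le {a : ℚ_[p]} (ha : ‖a‖ ≤ (p : ℝ)⁻¹) {ℓ : ℚ_[p]⟦X⟧} (h1 : coeff 1 ℓ = 1)
    (hT : ∀ n, ‖coeff n (hondaShift p a ℓ)‖ ≤ 1) {x y : K} {C : ℝ}
    (hb : ∀ j : ℕ, ‖x * algebraMap ℚ_[p] K (coeff (p ^ (j + 1)) ℓ) + y * algebraMap ℚ_[p] K (coeff (p ^ j) ℓ)‖ ≤ C) :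
    x = 0 ∧ y = 0 := by
  have hp1 : (1 : ℝ) < p := by exact_mod_cast hp.out.one_lt
  have hp0 : (0 : ℝ) < p := by positivity
  have hι : ∀ q : ℚ_[p], ‖algebraMap ℚ_[p] K q‖ = ‖q‖ := fun q ↦ norm_algebraMap' K q
  by_contra hne
  rcases le_or_gt ‖y‖ ‖x‖ with hyx | hxy
  · -- `x ≠ 0`; read the coefficient of `X^{p^{2k}}`, `j + 1 = 2k`, `j = 2k − 1` (`k ≥ 1`)
    have hx : x ≠ 0 := by
      rintro rfl
      rw [norm_zero, norm_le_zero_iff] at hyx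
      exact hne ⟨rfl, hyx⟩
    have hxpos : 0 < ‖x‖ := norm_pos_iff.mpr hx
    obtain ⟨k, hk⟩ := pow_unbounded_of_one_lt (C / ‖x‖) hp1
    -- use index `j = 2k + 1`, `j + 1 = 2(k+1)`
    have hj := hb (2 * k + 1)
    obtain ⟨he, -⟩ := norm_coeff_pow_pattern ha h1 hT (k + 1)
    obtain ⟨-, ho⟩ := norm_coeff_pow_pattern ha h1 hT k
    rw [show 2 * k + 1 + 1 = 2 * (k + 1) by ring] at hj
    have h1' : ‖x * algebraMap ℚ_[p] K (coeff (p ^ (2 * (k + 1))) ℓ)‖ = ‖x‖ * (p : ℝ) ^ (k + 1) := by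
      rw [norm_mul, hι, he]
    have h2' : ‖y * algebraMap ℚ_[p] K (coeff (p ^ (2 * k + 1)) ℓ)‖ ≤ ‖x‖ * (p : ℝ) ^ k := by
      rw [norm_mul, hι]
      exact mul_le_mul hyx ho (norm_nonneg _) (norm_nonneg _)
    have hlt : ‖y * algebraMap ℚ_[p] K (coeff (p ^ (2 * k + 1)) ℓ)‖ <
        ‖x * algebraMap ℚ_[p] K (coeff (p ^ (2 * (k + 1))) ℓ)‖ := by
      rw [h1']
      refine lt_of_le_of_lt h2' ?_
      rw [pow_succ]
      have : ‖x‖ * (p : ℝ) ^ k * 1 < ‖x‖ * (p : ℝ) ^ k * p := by gcongr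
      simpa [mul_assoc] using this
    have heq := IsUltrametricDist.norm_add_eq_max_of_norm_ne_norm hlt.ne'
    rw [max_eq_left hlt.le, h1'] at heq
    rw [heq] at hj
    have hC1 : C < (p : ℝ) ^ k * ‖x‖ := by
      have := mul_lt_mul_of_pos_right hk hxpos
      rwa [div_mul_cancel₀ C hxpos.ne'] at this
    have hC2 : (p : ℝ) ^ k * ‖x‖ ≤ ‖x‖ * (p : ℝ) ^ (k + 1) := by
      have h := mul_le_mul_of_nonneg_left hp1.le (mul_nonneg (pow_pos hp0 k).le hxpos.le)
      calc (p : ℝ) ^ k * ‖x‖ = (p : ℝ) ^ k * ‖x‖ * 1 := (mul_one _).symm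
        _ ≤ (p : ℝ) ^ k * ‖x‖ * p := h
        _ = ‖x‖ * (p : ℝ) ^ (k + 1) := by ring
    linarith
  · -- `y ≠ 0`; read the coefficient of `X^{p^{2k+1}}`, `j = 2k`
    have hy : y ≠ 0 := by
      rintro rfl
      rw [norm_zero] at hxy
      exact (not_lt.mpr (norm_nonneg x)) hxy
    have hypos : 0 < ‖y‖ := norm_pos_iff.mpr hy
    obtain ⟨k, hk⟩ := pow_unbounded_of_one_lt (C / ‖y‖) hp1
    have hj := hb (2 * k)
    obtain ⟨he, ho⟩ := norm_coeff_pow_pattern ha h1 hT k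
    have h1' : ‖y * algebraMap ℚ_[p] K (coeff (p ^ (2 * k)) ℓ)‖ = ‖y‖ * (p : ℝ) ^ k := by
      rw [norm_mul, hι, he]
    have h2' : ‖x * algebraMap ℚ_[p] K (coeff (p ^ (2 * k + 1)) ℓ)‖ ≤ ‖x‖ * (p : ℝ) ^ k := by
      rw [norm_mul, hι]
      exact mul_le_mul_of_nonneg_left ho (norm_nonneg _)
    have hlt : ‖x * algebraMap ℚ_[p] K (coeff (p ^ (2 * k + 1)) ℓ)‖ <
        ‖y * algebraMap ℚ_[p] K (coeff (p ^ (2 * k)) ℓ)‖ := by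
      rw [h1']
      exact lt_of_le_of_lt h2' (mul_lt_mul_of_pos_right hxy (pow_pos hp0 k))
    have heq := IsUltrametricDist.norm_add_eq_max_of_norm_ne_norm hlt.ne
    rw [max_eq_right hlt.le, h1'] at heq
    rw [heq] at hj
    have hC1 : C < (p : ℝ) ^ k * ‖y‖ := by
      have := mul_lt_mul_of_pos_right hk hypos
      rwa [div_mul_cancel₀ C hypos.ne'] at this
    linarith [mul_comm ((p : ℝ) ^ k) ‖y‖]

omit [IsUltrametricDist K] in
/-- The `X^{p^{j+1}}`-coefficient of `C x · ι(ℓ) + C y · ι(ℓ)(Xᵖ)` is `x·ι(ℓ_{p^{j+1}}) + y·ι(ℓ_{p^j})`.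
[folklore] -/
theorem coeff_pow_succ_combination (ℓ : ℚ_[p]⟦X⟧) (x y : K) (j : ℕ) :
    coeff (p ^ (j + 1)) (C x * ℓ.map (algebraMap ℚ_[p] K) +
        C y * expand p (prime_ne_zero p) (ℓ.map (algebraMap ℚ_[p] K))) =
      x * algebraMap ℚ_[p] K (coeff (p ^ (j + 1)) ℓ) + y * algebraMap ℚ_[p] K (coeff (p ^ j) ℓ) := by
  rw [map_add, coeff_C_mul, coeff_C_mul, coeff_map, pow_succ', coeff_expand_mul, coeff_map]

/-- **Independence, series form: `x·ℓ + y·ℓ(Xᵖ)` has bounded coefficients in `K⟦X⟧` only for `x = y = 0`** —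
`[ℓ]` and `F[ℓ] = [ℓ(Xᵖ)]` are `K`-linearly independent in Katz's `D_ℚ ⊗ K`. [cite: Katz1981CrystallineDieudonne, §5] -/
theorem eq_zero_of_norm_coeff_combination_le {a : ℚ_[p]} (ha : ‖a‖ ≤ (p : ℝ)⁻¹) {ℓ : ℚ_[p]⟦X⟧}
    (h1 : coeff 1 ℓ = 1) (hT : ∀ n, ‖coeff n (hondaShift p a ℓ)‖ ≤ 1) {x y : K} {C : ℝ}
    (hb : ∀ n : ℕ, ‖coeff n (PowerSeries.C x * ℓ.map (algebraMap ℚ_[p] K) +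
        PowerSeries.C y * expand p (prime_ne_zero p) (ℓ.map (algebraMap ℚ_[p] K)))‖ ≤ C) :
    x = 0 ∧ y = 0 :=
  eq_zero_of_norm_combination_le ha h1 hT fun j ↦ by rw [← coeff_pow_succ_combination]; exact hb _

/-- **(u)-engine: coordinates on `([ℓ], [ℓ(Xᵖ)])` are unique modulo bounded series.** If
`x·ℓ + y·ℓ(Xᵖ)` and `x′·ℓ + y′·ℓ(Xᵖ)` differ by a series with bounded coefficients then `x = x′`, `y = y′`.
[cite: Katz1981CrystallineDieudonne, §5] -/
theorem combination_coeffs_unique {a : ℚ_[p]} (ha : ‖a‖ ≤ (p : ℝ)⁻¹) {ℓ : ℚ_[p]⟦X⟧}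
    (h1 : coeff 1 ℓ = 1) (hT : ∀ n, ‖coeff n (hondaShift p a ℓ)‖ ≤ 1) {x y x' y' : K} {C : ℝ}
    (hb : ∀ n : ℕ, ‖coeff n ((PowerSeries.C x * ℓ.map (algebraMap ℚ_[p] K) +
        PowerSeries.C y * expand p (prime_ne_zero p) (ℓ.map (algebraMap ℚ_[p] K))) -
        (PowerSeries.C x' * ℓ.map (algebraMap ℚ_[p] K) +
        PowerSeries.C y' * expand p (prime_ne_zero p) (ℓ.map (algebraMap ℚ_[p] K))))‖ ≤ C) :
    x = x' ∧ y = y' := by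
  have key : ∀ n : ℕ, ‖coeff n (PowerSeries.C (x - x') * ℓ.map (algebraMap ℚ_[p] K) +
      PowerSeries.C (y - y') * expand p (prime_ne_zero p) (ℓ.map (algebraMap ℚ_[p] K)))‖ ≤ C := by
    intro n
    have e : PowerSeries.C (x - x') * ℓ.map (algebraMap ℚ_[p] K) +
        PowerSeries.C (y - y') * expand p (prime_ne_zero p) (ℓ.map (algebraMap ℚ_[p] K)) =
        (PowerSeries.C x * ℓ.map (algebraMap ℚ_[p] K) +
          PowerSeries.C y * expand p (prime_ne_zero p) (ℓ.map (algebraMap ℚ_[p] K))) -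
        (PowerSeries.C x' * ℓ.map (algebraMap ℚ_[p] K) +
          PowerSeries.C y' * expand p (prime_ne_zero p) (ℓ.map (algebraMap ℚ_[p] K))) := by
      simp only [map_sub]; ring
    rw [e]; exact hb n
  obtain ⟨hx, hy⟩ := eq_zero_of_norm_coeff_combination_le ha h1 hT key
  exact ⟨sub_eq_zero.mp hx, sub_eq_zero.mp hy⟩

omit [IsUltrametricDist K] in
/-- Injectivity of `f ↦ f(X^q)` modulo bounded series: the coefficients of `f(X^q)` ARE those of `f`
(`[X^{qm}] f(X^q) = [X^m] f`), so one is bounded iff the other is. (The Berthelot–Ogus transfer `Ψ[f] = [f(T⁹)]`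
of the memo is injective on classes for this reason.) [folklore] -/
theorem norm_coeff_le_of_expand {q : ℕ} (hq : q ≠ 0) {f : K⟦X⟧} {C : ℝ}
    (hb : ∀ n, ‖coeff n (expand q hq f)‖ ≤ C) : ∀ m, ‖coeff m f‖ ≤ C := fun m ↦ by
  have := hb (q * m)
  rwa [coeff_expand_mul] at this

omit [IsUltrametricDist K] in
/-- … and conversely. [folklore] -/
theorem norm_coeff_expand_le {q : ℕ} (hq : q ≠ 0) {f : K⟦X⟧} {C : ℝ} (hC : 0 ≤ C)
    (hb : ∀ m, ‖coeff m f‖ ≤ C) : ∀ n, ‖coeff n (expand q hq f)‖ ≤ C := fun n ↦ by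
  rw [coeff_expand]
  split_ifs
  · exact hb _
  · rw [norm_zero]; exact hC

/-- **The Frobenius relation `(F² − aF + p)[ℓ] ≡ 0 (mod p)`**: `ℓ(X^{p²}) − a·ℓ(Xᵖ) + p·ℓ = p·hondaShift p a ℓ`
has coefficients of norm `≤ p⁻¹` when `ℓ` is of type `p − aT + T²`. [cite: Honda1970, Thm. 9] -/
theorem norm_coeff_frobenius_relation_le {a : ℚ_[p]} {ℓ : ℚ_[p]⟦X⟧}
    (hT : ∀ n, ‖coeff n (hondaShift p a ℓ)‖ ≤ 1) (n : ℕ) :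
    ‖coeff n (expand (p ^ 2) (prime_sq_ne_zero p) ℓ - PowerSeries.C a * expand p (prime_ne_zero p) ℓ +
        PowerSeries.C (p : ℚ_[p]) * ℓ)‖ ≤ (p : ℝ)⁻¹ := by
  have hp0 : (p : ℚ_[p]) ≠ 0 := by exact_mod_cast hp.out.ne_zero
  have e : expand (p ^ 2) (prime_sq_ne_zero p) ℓ - PowerSeries.C a * expand p (prime_ne_zero p) ℓ +
      PowerSeries.C (p : ℚ_[p]) * ℓ = PowerSeries.C (p : ℚ_[p]) * hondaShift p a ℓ := by
    rw [hondaShift_def, mul_add, mul_sub, ← mul_assoc, ← mul_assoc, ← map_mul, ← map_mul,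
      show (p : ℚ_[p]) * (a / p) = a by field_simp, show (p : ℚ_[p]) * (1 / (p : ℚ_[p])) = 1 by field_simp,
      map_one, one_mul]
    ring
  rw [e, coeff_C_mul, norm_mul, Padic.norm_p]
  calc (p : ℝ)⁻¹ * ‖coeff n (hondaShift p a ℓ)‖ ≤ (p : ℝ)⁻¹ * 1 := by gcongr; exact hT n
    _ = (p : ℝ)⁻¹ := mul_one _

/-- **Frobenius acts by the companion matrix of `X² − aX + p` on `(ℓ, Fℓ)`, `F = expand p`:**
`F(x·ℓ + y·Fℓ) − ((−p·y)·ℓ + (x + a·y)·Fℓ) = y·(ℓ(X^{p²}) − a·ℓ(Xᵖ) + p·ℓ)` (an identity in `ℚ_p⟦X⟧`).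
[cite: Katz1981CrystallineDieudonne, §5] -/
theorem expand_combination_companion (a x y : ℚ_[p]) (ℓ : ℚ_[p]⟦X⟧) :
    expand p (prime_ne_zero p) (PowerSeries.C x * ℓ + PowerSeries.C y * expand p (prime_ne_zero p) ℓ) -
        (PowerSeries.C (-(p : ℚ_[p]) * y) * ℓ + PowerSeries.C (x + a * y) * expand p (prime_ne_zero p) ℓ) =
      PowerSeries.C y * (expand (p ^ 2) (prime_sq_ne_zero p) ℓ -
        PowerSeries.C a * expand p (prime_ne_zero p) ℓ + PowerSeries.C (p : ℚ_[p]) * ℓ) := by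
  have hexp : expand p (prime_ne_zero p) (expand p (prime_ne_zero p) ℓ) =
      expand (p ^ 2) (prime_sq_ne_zero p) ℓ := by
    rw [← expand_mul]
    ext n
    simp only [coeff_expand, pow_two]
  rw [map_add, map_mul, map_mul, expand_C, expand_C, hexp]
  simp only [map_neg, map_mul, map_add, map_natCast]
  ring

/-- **… hence `F(x·ℓ + y·Fℓ) ≡ (−p·y)·ℓ + (x + a·y)·Fℓ` modulo a series with coefficients of norm `≤ ‖y‖·p⁻¹`:**
the matrix of Frobenius on Katz's classes `([ℓ], [ℓ(Xᵖ)])` is the companion matrix `!![0, −p; 1, a]` (columns =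
images), trace `a`, determinant `p`. [cite: Katz1981CrystallineDieudonne, §5] [cite: Honda1970, Thm. 9] -/
theorem norm_coeff_expand_combination_sub_companion_le {a : ℚ_[p]} {ℓ : ℚ_[p]⟦X⟧}
    (hT : ∀ n, ‖coeff n (hondaShift p a ℓ)‖ ≤ 1) (x y : ℚ_[p]) (n : ℕ) :
    ‖coeff n (expand p (prime_ne_zero p) (PowerSeries.C x * ℓ + PowerSeries.C y * expand p (prime_ne_zero p) ℓ) -
        (PowerSeries.C (-(p : ℚ_[p]) * y) * ℓ + PowerSeries.C (x + a * y) * expand p (prime_ne_zero p) ℓ))‖ ≤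
      ‖y‖ * (p : ℝ)⁻¹ := by
  rw [expand_combination_companion, coeff_C_mul, norm_mul]
  exact mul_le_mul_of_nonneg_left (norm_coeff_frobenius_relation_le hT n) (norm_nonneg y)

end Independence

end Summit.BirchSwinnertonDyer.BirchSwinnertonDyer.Theorems.SecondKindLogClasses
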